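import Summits.AtomisticToContinuum.BoseEinsteinCondensation.Theorems.BECCutLineWeakDisorderDefs
import Literature.MathematicalPhysics.QuantumManyBody.GroundStateFeynmanKacInteraction
import Literature.MathematicalPhysics.QuantumManyBody.SwapPurity
import HarnessLib

/-!
# Route `BECCutLineWeakDisorder`, crux `TwoReplicaTransienceBound` (stmt-AtomisticToContinuum-9687),
# line `SketchIdeator1` (tracer decoupling): stub `stub_tracerMeasurable`

Support file (`--supports stmt-AtomisticToContinuum-9687`): proves the registered stub
`stub_tracerMeasurable : Goal.stub_tracerMeasurable` (statement `TracerMeasurable` of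
`Theorems/BECCutLineWeakDisorderDefs.lean`): joint measurability of the passive-tracer survival
functional `(x, ωb) ↦ tracer v L T x Y ωb` in the tagged starting point `x` and the bath sample `ωb`.

Proof: `tracer v L T x Y ωb = ∫ H((x, ωb), ω₀) dwienerLine(ω₀)` with the integrand
`H = 𝟙{tagged survival}(x, ω₀) · e^{-(tagged–bath action)(x, ω₀, ωb)}`, jointly measurable in
`((x, ωb), ω₀)`:
* the tagged–bath action is the time integral over `(0, T]` of
  `∑ⱼ v(|B⁰_s − B^{j+1}_s|)` read on the `(n+1)`-line world-lines of the measurable slice-and-sample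
  map `((x, ωb), ω₀) ↦ (x :: Y, Fin.cons ω₀ ωb)`, jointly measurable in (configuration, sample, real
  time) (`measurable_worldLine₃`), so it is measurable by the Tonelli measurability lemma
  `Measurable.lintegral_prod_right'`;
* the tagged survival event is the preimage under `((x, ωb), ω₀) ↦ ((fun _ => x), (fun _ => ω₀))`
  of the one-line event `{(X₁, ω₁) | ω₁ ∈ survives L T X₁}`, measurable by the countable
  (rational-times) description of "a continuous curve stays in an open set on `[0, T]`"
  (`measurableSet_forall_mem_Icc`);
and `Measurable.lintegral_prod_right'` once more (`wienerLine` is a probability measure).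
-/

noncomputable section

namespace Summit.AtomisticToContinuum.BoseEinsteinCondensation.Cruxes.TwoReplicaTransienceBound.TracerDecoupling

open MeasureTheory Filter Set
open scoped ENNReal NNReal Topology BigOperators
open Literature.MathematicalPhysics.QuantumManyBody.BoseGas
open Literature.Probability.Process (preWienerMeasure brownian measurable_brownian continuous_brownian)

/-! ### Joint measurability of the pieces of the tracer integrand (helpers) -/

namespace TracerMeasurability

variable {n : ℕ}

/-- Measurability of `a ↦ Fin.cons (x a) (q a)` for measurable `x`, `q` (coordinate by coordinate,
`Fin.cases`; same three lines as `measurable_finCons` of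
`Literature/Analysis/FunctionSpaces/PointConfigFactorialMeasure.lean`). -/
theorem measurable_finCons {α β : Type*} [MeasurableSpace α] [MeasurableSpace β] {k : ℕ}
    {x : α → β} {q : α → Fin k → β} (hx : Measurable x) (hq : Measurable q) :
    Measurable fun a => (Fin.cons (x a) (q a) : Fin (k + 1) → β) := by
  refine measurable_pi_iff.2 (Fin.cases ?_ fun i => ?_)
  · simpa only [Fin.cons_zero] using hx
  · simpa only [Fin.cons_succ] using measurable_pi_iff.1 hq i

/-- The world-lines read along measurable parametrisations `a ↦ (X a, ω a, s a)` of the starting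
configuration, the sample and real time are measurable (from `measurable_worldLine₃`). -/
theorem measurable_worldLine_param {N : ℕ} {α : Type*} [MeasurableSpace α] {X : α → Config N}
    {ω : α → PathSpace N} {s : α → ℝ} (hX : Measurable X) (hω : Measurable ω) (hs : Measurable s) :
    Measurable fun a => worldLine (X a) (ω a) (s a).toNNReal :=
  measurable_worldLine₃.comp (hX.prodMk (hω.prodMk hs))

/-- The tagged–bath integrand `∑ⱼ v(|B⁰_s − B^{j+1}_s|)` of `n + 1` world-lines, read along
measurable parametrisations of (starting configuration, sample, real time), is measurable (for
measurable `v`). -/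
theorem measurable_taggedBathIntegrand {v : ℝ → ℝ≥0∞} (hv : Measurable v) {α : Type*}
    [MeasurableSpace α] {X : α → Config (n + 1)} {ω : α → PathSpace (n + 1)} {s : α → ℝ}
    (hX : Measurable X) (hω : Measurable ω) (hs : Measurable s) :
    Measurable fun a => ∑ j : Fin n,
      v (dist (worldLine (X a) (ω a) (s a).toNNReal 0) (worldLine (X a) (ω a) (s a).toNNReal j.succ)) := by
  have hW : Measurable fun a => worldLine (X a) (ω a) (s a).toNNReal :=
    measurable_worldLine_param hX hω hs
  refine Finset.measurable_sum _ fun j _ => hv.comp ?_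
  exact ((measurable_pi_apply (0 : Fin (n + 1))).comp hW).dist
    ((measurable_pi_apply (j.succ : Fin (n + 1))).comp hW)

/-- **Joint measurability of the tagged–bath action** `((x, ωb), ω₀) ↦ taggedBathAction v T x Y ω₀ ωb`
(Tonelli measurability of the time integral of the jointly measurable integrand along the
slice-and-sample map `((x, ωb), ω₀) ↦ (x :: Y, Fin.cons ω₀ ωb)`). -/
theorem measurable_taggedBathAction {v : ℝ → ℝ≥0∞} (hv : Measurable v) (T : ℝ) (Y : Config n) :
    Measurable fun q : (Space × PathSpace n) × (Fin 3 → (ℝ≥0 → ℝ)) =>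
      taggedBathAction v T q.1.1 Y q.2 q.1.2 := by
  have hX : Measurable fun r : ((Space × PathSpace n) × (Fin 3 → (ℝ≥0 → ℝ))) × ℝ =>
      (Matrix.vecCons r.1.1.1 Y : Config (n + 1)) :=
    measurable_vecCons.comp
      ((measurable_fst.comp (measurable_fst.comp measurable_fst)).prodMk measurable_const)
  have hω : Measurable fun r : ((Space × PathSpace n) × (Fin 3 → (ℝ≥0 → ℝ))) × ℝ =>
      (Fin.cons r.1.2 r.1.1.2 : PathSpace (n + 1)) :=
    measurable_finCons (measurable_snd.comp measurable_fst)
      (measurable_snd.comp (measurable_fst.comp measurable_fst))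
  have h : Measurable fun r : ((Space × PathSpace n) × (Fin 3 → (ℝ≥0 → ℝ))) × ℝ => ∑ j : Fin n,
      v (dist (worldLine (Matrix.vecCons r.1.1.1 Y) (Fin.cons r.1.2 r.1.1.2) r.2.toNNReal 0)
        (worldLine (Matrix.vecCons r.1.1.1 Y) (Fin.cons r.1.2 r.1.1.2) r.2.toNNReal j.succ)) :=
    measurable_taggedBathIntegrand hv hX hω measurable_snd
  unfold taggedBathAction
  exact h.lintegral_prod_right'

/-- The survival event is jointly measurable in the starting configuration and the sample:
`{(X, ω) | ω ∈ survives L T X}` is a measurable subset of `Config N × PathSpace N` (rational-times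
description of "the continuous world-lines stay in the open box on `[0, T]`"). -/
theorem measurableSet_survives_prod (N : ℕ) (L T : ℝ) :
    MeasurableSet {q : Config N × PathSpace N | q.2 ∈ survives L T q.1} :=
  measurableSet_forall_mem_Icc (U := boxN N L)
    (γ := fun (q : Config N × PathSpace N) (s : ℝ) => worldLine q.1 q.2 s.toNNReal)
    (isOpen_boxN N L) (fun q => continuous_worldLine_toNNReal q.1 q.2)
    (fun s => measurable_worldLine_uncurry' s.toNNReal) T

/-- The tagged survival event `{((x, ωb), ω₀) | (fun _ => ω₀) ∈ survives L T (fun _ => x)}` (one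
Brownian line from `x` stays in `Λ_L` on `[0, T]`) is measurable. -/
theorem measurableSet_taggedSurvives (L T : ℝ) :
    MeasurableSet {q : (Space × PathSpace n) × (Fin 3 → (ℝ≥0 → ℝ)) |
      (fun _ : Fin 1 => q.2) ∈ survives (N := 1) L T (fun _ => q.1.1)} := by
  have hψ : Measurable fun q : (Space × PathSpace n) × (Fin 3 → (ℝ≥0 → ℝ)) =>
      ((fun _ : Fin 1 => q.1.1 : Config 1), (fun _ : Fin 1 => q.2 : PathSpace 1)) :=
    (measurable_pi_lambda _ fun _ => measurable_fst.comp measurable_fst).prodMk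
      (measurable_pi_lambda _ fun _ => measurable_snd)
  exact hψ (measurableSet_survives_prod 1 L T)

/-- The tagged survival indicator `((x, ωb), ω₀) ↦ 𝟙{(fun _ => ω₀) ∈ survives L T (fun _ => x)}`
is measurable. -/
theorem measurable_taggedIndicator (L T : ℝ) :
    Measurable fun q : (Space × PathSpace n) × (Fin 3 → (ℝ≥0 → ℝ)) =>
      (survives (N := 1) L T (fun _ => q.1.1)).indicator (fun _ => (1 : ℝ≥0∞)) (fun _ => q.2) := by
  have heq : (fun q : (Space × PathSpace n) × (Fin 3 → (ℝ≥0 → ℝ)) =>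
      (survives (N := 1) L T (fun _ => q.1.1)).indicator (fun _ => (1 : ℝ≥0∞)) (fun _ => q.2)) =
      {q : (Space × PathSpace n) × (Fin 3 → (ℝ≥0 → ℝ)) |
        (fun _ : Fin 1 => q.2) ∈ survives (N := 1) L T (fun _ => q.1.1)}.indicator
        fun _ => (1 : ℝ≥0∞) := by
    funext q
    by_cases h : (fun _ : Fin 1 => q.2) ∈ survives (N := 1) L T (fun _ => q.1.1)
    · have h' : q ∈ {q : (Space × PathSpace n) × (Fin 3 → (ℝ≥0 → ℝ)) |
          (fun _ : Fin 1 => q.2) ∈ survives (N := 1) L T (fun _ => q.1.1)} := h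
      rw [Set.indicator_of_mem h, Set.indicator_of_mem h']
    · have h' : q ∉ {q : (Space × PathSpace n) × (Fin 3 → (ℝ≥0 → ℝ)) |
          (fun _ : Fin 1 => q.2) ∈ survives (N := 1) L T (fun _ => q.1.1)} := h
      rw [Set.indicator_of_notMem h, Set.indicator_of_notMem h']
  rw [heq]
  exact measurable_const.indicator (measurableSet_taggedSurvives L T)

/-- **Joint measurability of the tracer integrand**
`((x, ωb), ω₀) ↦ 𝟙{tagged survival} · e^{-(tagged–bath action)}`. -/
theorem measurable_tracerIntegrand {v : ℝ → ℝ≥0∞} (hv : Measurable v) (L T : ℝ) (Y : Config n) :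
    Measurable fun q : (Space × PathSpace n) × (Fin 3 → (ℝ≥0 → ℝ)) =>
      (survives (N := 1) L T (fun _ => q.1.1)).indicator (fun _ => (1 : ℝ≥0∞)) (fun _ => q.2) *
        expNeg (taggedBathAction v T q.1.1 Y q.2 q.1.2) :=
  (measurable_taggedIndicator L T).mul (measurable_expNeg.comp (measurable_taggedBathAction hv T Y))

end TracerMeasurability

/-! ### The stub -/

open TracerMeasurability in
/-- Registered stub `stub_tracerMeasurable` of line SketchIdeator1 (statement `TracerMeasurable`):
`(x, ωb) ↦ tracer v L T x Y ωb = ∫ 𝟙{tagged survival}(x, ω₀) e^{-(tagged–bath action)(x, ω₀, ωb)} dW(ω₀)`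
is jointly measurable — the integrand is jointly measurable in `((x, ωb), ω₀)`
(`measurable_tracerIntegrand`) and `wienerLine` is a probability (hence s-finite) measure
(`Measurable.lintegral_prod_right'`). -/
theorem stub_tracerMeasurable : Goal.stub_tracerMeasurable := by
  intro n v hv L T Y
  exact (measurable_tracerIntegrand hv L T Y).lintegral_prod_right' (ν := wienerLine)

end Summit.AtomisticToContinuum.BoseEinsteinCondensation.Cruxes.TwoReplicaTransienceBound.TracerDecoupling

end
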